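import Mathlib
import HarnessLib
import Summits.HubbardSuperconductivity.HubbardSuperconductivity.Theorems.KLProgrammeKLRegimeVolumeLimitHE1FreeOfEngineTop

/-!
# Route `KLProgramme` — VL item stmt-HubbardSuperconductivity-23356 `KLRegimeVolumeLimitV17F3` (skeleton «cauchy» v12W-9, 3fe75b6ca60710d7):
# THE TWO REGISTERED ATOMS `stub_vl_HE1free` (17cc1cbcff73) AND `stub_vl_flowPieceOscTE` (398b3e3a086b) FROM THE ONE ENGINE TEXT «ENG-X»
# (cell gate-hubbard-kl, seat hubbard-kl-k3c4-p1 g21, VL lead; sequel of `…VolumeLimitHE1FreeOfEngineTop`)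

`…VolumeLimitHE1FreeOfEngineTop` (this seat) derives the package-free top-frame export HtopEvenFree′ from children 1, 2 and ENG-X (`htopFree'_of_children`) and
projects ENG-X to ENG-OSC (`engineOsc_of_engineP4X`).  Here:

* **`he1free'_of_htopFree'`** — HtopEvenFree′ ⇒ the registered text of `stub_vl_HE1free`: `S₀ j m := 0` at odd `m` (parity
  `klWtPinnedSumAt_klEffectiveAction_eq_zero_of_odd`), `:= C₀·Q₁.CE·ε_{n_β+1}·4^{−(j+1)}` at `m = 2`, `:= C₀·klWtBudget P Q₁ U (j+1) m` at even `m ≥ 4`; degree `0` has no pin;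
* **`he1free'_of_engineP4X`** `: ENG-X → <stub_vl_HE1free>` and **`oscTE_of_engineP4X`** `: ENG-X → <stub_vl_flowPieceOscTE>` (p2 g25's `hoscTAtom_of_engineOsc` ∘
  `engineOsc_of_engineP4X`) — so the VL image closes by TWO `exact`s the day the engine image exports ENG-X (its `engine_slots_of_stubs_v2x` +
  `flowPieceOsc_hist_of_stubs_v2x` + the top-frame read-out row ROW-T, one §C corollary).

Pure composition; no definition; nothing here asserts ENG-X, ROW-T, either atom, any stub of 20437, VL, K3 or superconductivity.
References: BGM 2006 §2.4 (2.36), §2.8 (2.83), §3 [cite: BenfattoGiulianiMastropietro2006].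
-/

noncomputable section

namespace Summit.HubbardSuperconductivity.HubbardSuperconductivity.Theorems.KLRegimeSplit

set_option linter.dupNamespace false -- summit = problem name (single-conjunct summit), D-0017

open Real Finset Literature.MathematicalPhysics.QuantumLattice Literature.Probability.LatticeModels GrassmannAlgebra
open Literature.MathematicalPhysics.QuantumLattice.FermiRG
open Summit.HubbardSuperconductivity.HubbardSuperconductivity.Theorems.KLProgrammeLegKernels
open Summit.HubbardSuperconductivity.HubbardSuperconductivity.Theorems.DispersionFlow
open Summit.HubbardSuperconductivity.HubbardSuperconductivity.Theorems.EngineV8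
open Summit.HubbardSuperconductivity.HubbardSuperconductivity.Theorems.TwoVolumeSource

/-! ## §1 HtopEvenFree′ packages into the registered atom text -/

set_option maxHeartbeats 1600000 in -- long binders
/-- **HtopEvenFree′ ⇒ the registered text of `stub_vl_HE1free` (v12W-9, 17cc1cbcff73)**: `S₀ j m := 0` at odd `m` (parity), `C₀·Q₁.CE·ε_{n_β+1}·4^{−(j+1)}` at
`m = 2`, `C₀·klWtBudget P Q₁ U (j+1) m` at even `m ≥ 4`; degree `0` has no pin. [cite: BenfattoGiulianiMastropietro2006, §2.8 (2.83)] -/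
theorem he1free'_of_htopFree'
    (Htop : ∀ (P : SplitConsts) (R : RenConsts), P.WF → R.WF2 →
      ∃ Q₁ : EngConsts, 0 ≤ Q₁.CE ∧ ∃ C₀ : ℝ, 0 ≤ C₀ ∧
        ∃ c₇ : ℝ, 0 < c₇ ∧ ∀ c : ℝ, 0 < c → c ≤ c₇ → ∃ U₇ : ℝ, 0 < U₇ ∧
          ∀ μ ∈ klWindowC, ∀ U : ℝ, 0 < U → U ≤ U₇ → ∀ β : ℝ, klBetaMin ≤ β → β ≤ Real.exp (c / U ^ 2) →
            ∃ L₂ : ℕ, ∃ M₂ : ℕ → ℕ, ∀ (L M : ℕ) [NeZero L] [NeZero M], L₂ ≤ L → M₂ L ≤ M →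
              (∀ k, k ≤ nScales β → hubbardEffPartitionFnCT L M β U μ 0 (klFlowFrameU L M β U μ (nScales β + 1)) (klScale klE0 (k + 1)) ≠ 0) ∧
              (∀ j, j ≤ nScales β → ∀ p : ℕ, 2 ≤ p → ∀ (q : Fin (2 * p)) (w : SpaceTimeIdx L M × SectorLeg (sectorCount j)),
                klWtPinnedSumAt L M β μ (klFlowFrameU L M β U μ (nScales β + 1)) j j (2 * p)
                  (klEffectiveAction L M β U μ (klFlowFrameU L M β U μ (nScales β + 1)) klE0 (j + 1)) q w ≤ C₀ * klWtBudget P Q₁ U (j + 1) (2 * p)) ∧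
              (∀ j, j ≤ nScales β → ∀ (q : Fin 2) (w : SpaceTimeIdx L M × SectorLeg (sectorCount j)),
                klWtPinnedSumAt L M β μ (klFlowFrameU L M β U μ (nScales β + 1)) j j 2
                  (klEffectiveAction L M β U μ (klFlowFrameU L M β U μ (nScales β + 1)) klE0 (j + 1)) q w ≤
                    C₀ * Q₁.CE * epsCoupling P U (nScales β + 1) * ((4 : ℝ) ^ (j + 1))⁻¹)) :
    ∀ (P : SplitConsts) (R : RenConsts), P.WF → R.WF2 →
      ∃ Q₁ : EngConsts, 0 ≤ Q₁.CE ∧ ∃ C₀ : ℝ, 0 ≤ C₀ ∧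
        ∃ c₇ : ℝ, 0 < c₇ ∧ ∀ c : ℝ, 0 < c → c ≤ c₇ → ∃ U₇ : ℝ, 0 < U₇ ∧
          ∀ μ ∈ klWindowC, ∀ U : ℝ, 0 < U → U ≤ U₇ → ∀ β : ℝ, klBetaMin ≤ β → β ≤ Real.exp (c / U ^ 2) →
            ∃ S₀ : ℕ → ℕ → ℝ, (∀ j m, 0 ≤ S₀ j m) ∧ (∀ j, j ≤ nScales β → ∀ m, 2 ≤ m → S₀ j (2 * m) ≤ C₀ * klWtBudget P Q₁ U (j + 1) (2 * m)) ∧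
            (∀ j, j ≤ nScales β → S₀ j 2 ≤ C₀ * Q₁.CE * epsCoupling P U (nScales β + 1) * ((4 : ℝ) ^ (j + 1))⁻¹) ∧
            ∃ L₂ : ℕ, ∃ M₂ : ℕ → ℕ, ∀ (L M : ℕ) [NeZero L] [NeZero M], L₂ ≤ L → M₂ L ≤ M →
              (∀ k, k ≤ nScales β → hubbardEffPartitionFnCT L M β U μ 0 (klFlowFrameU L M β U μ (nScales β + 1)) (klScale klE0 (k + 1)) ≠ 0) ∧
              (∀ j, j ≤ nScales β → ∀ (m : ℕ) (q : Fin m) (w : SpaceTimeIdx L M × SectorLeg (sectorCount j)),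
                klWtPinnedSumAt L M β μ (klFlowFrameU L M β U μ (nScales β + 1)) j j m (klEffectiveAction L M β U μ (klFlowFrameU L M β U μ (nScales β + 1)) klE0 (j + 1)) q w ≤ S₀ j m) := by
  classical
  intro P R hP hR2
  obtain ⟨Q₁, hCE, C₀, hC₀, c₇, hc₇, h⟩ := Htop P R hP hR2
  have hKl : 0 ≤ P.Klam := le_trans zero_le_one hP.1
  refine ⟨Q₁, hCE, C₀, hC₀, c₇, hc₇, fun c hc hcc => ?_⟩
  obtain ⟨U₇, hU₇, h'⟩ := h c hc hcc
  refine ⟨U₇, hU₇, fun μ hμ U hU hUU β hβmin hβc => ?_⟩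
  have hβ0 : β ≠ 0 := (pos_of_klBetaMin_le hβmin).ne'
  obtain ⟨L₂, M₂, hI⟩ := h' μ hμ U hU hUU β hβmin hβc
  have hε0 : 0 ≤ epsCoupling P U (nScales β + 1) := epsCoupling_nonneg' hKl U _
  refine ⟨fun j m => if Even m then (if m = 2 then C₀ * Q₁.CE * epsCoupling P U (nScales β + 1) * ((4 : ℝ) ^ (j + 1))⁻¹
      else C₀ * klWtBudget P Q₁ U (j + 1) m) else 0, fun j m => ?_, fun j _ m hm => ?_, fun j _ => ?_, L₂, M₂, fun L M _ _ hL hM => ?_⟩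
  · show 0 ≤ (if Even m then (if m = 2 then C₀ * Q₁.CE * epsCoupling P U (nScales β + 1) * ((4 : ℝ) ^ (j + 1))⁻¹
      else C₀ * klWtBudget P Q₁ U (j + 1) m) else 0)
    split_ifs
    · positivity
    · exact mul_nonneg hC₀ (klWtBudget_nonneg hCE hKl U (j + 1) m)
    · exact le_rfl
  · show (if Even (2 * m) then (if 2 * m = 2 then C₀ * Q₁.CE * epsCoupling P U (nScales β + 1) * ((4 : ℝ) ^ (j + 1))⁻¹
      else C₀ * klWtBudget P Q₁ U (j + 1) (2 * m)) else 0) ≤ C₀ * klWtBudget P Q₁ U (j + 1) (2 * m)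
    rw [if_pos (even_two_mul m), if_neg (by omega)]
  · show (if Even 2 then (if (2 : ℕ) = 2 then C₀ * Q₁.CE * epsCoupling P U (nScales β + 1) * ((4 : ℝ) ^ (j + 1))⁻¹
      else C₀ * klWtBudget P Q₁ U (j + 1) 2) else 0) ≤ C₀ * Q₁.CE * epsCoupling P U (nScales β + 1) * ((4 : ℝ) ^ (j + 1))⁻¹
    rw [if_pos even_two, if_pos rfl]
  · obtain ⟨hZ, hR4, hR2⟩ := hI L M hL hM
    refine ⟨hZ, fun j hj m q w => ?_⟩
    show _ ≤ (if Even m then (if m = 2 then C₀ * Q₁.CE * epsCoupling P U (nScales β + 1) * ((4 : ℝ) ^ (j + 1))⁻¹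
      else C₀ * klWtBudget P Q₁ U (j + 1) m) else 0)
    rcases Nat.even_or_odd m with he | ho
    · rw [if_pos he]
      obtain ⟨p, hp⟩ := he
      have hm2 : m = 2 * p := by rw [hp]; ring
      subst hm2
      rcases Nat.lt_or_ge p 2 with hp2 | hp2
      · interval_cases p
        · exact q.elim0
        · rw [if_pos rfl]; exact hR2 j hj q w
      · rw [if_neg (by omega)]; exact hR4 j hj p hp2 q w
    · rw [if_neg (Nat.not_even_iff_odd.2 ho), klWtPinnedSumAt_klEffectiveAction_eq_zero_of_odd hβ0 U μ _ j j (j + 1) ho q w]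

/-! ## §2 The two v12W-9 atoms from ENG-X alone -/

set_option maxHeartbeats 1600000 in -- long binders
/-- **`stub_vl_HE1free` (v12W-9 text, 17cc1cbcff73) FROM ENG-X ALONE** (children 1, 2 discharged by `betaSplitP_klPredsV17F2 klWindowC` ✓ / `countertermP2_klPredsV17F2_holds` ✓).
[cite: BenfattoGiulianiMastropietro2006, §2.8 (2.83), §3] -/
theorem he1free'_of_engineP4X
    (hX : ∃ G : GeoConsts, G.WF ∧ ∀ P : SplitConsts, P.WF → ∀ R : RenConsts, R.WF2 → ∃ Q : EngConsts, Q.WF ∧ ∃ c₃ : ℝ, 0 < c₃ ∧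
      ∃ c'' : ℝ, 0 ≤ c'' ∧ ∃ C₀ : ℝ, 0 ≤ C₀ ∧ ∀ c : ℝ, 0 < c → c ≤ c₃ →
        ∃ U₀ : ℝ, 0 < U₀ ∧ ∃ L₃ : ℝ → ℝ → ℕ, ∃ M₃ : ℝ → ℝ → ℕ → ℕ,
          ∀ μ ∈ klWindowC, ∀ U : ℝ, 0 < U → U ≤ U₀ → ∀ β : ℝ, klBetaMin ≤ β → β ≤ Real.exp (c / U ^ 2) →
            ∀ K : TrigPolyC4v, klPredsV17F2.frameOK R U (nScales β) μ K →
              ∀ (L M : ℕ) [NeZero L] [NeZero M], L₃ β U ≤ L → M₃ β U L ≤ M →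
                ∀ n : ℕ, n ≤ nScales β + 1 → IsKLRegime U c (-(n : ℤ)) → HistP klPredsV17F2 L M G P Q R β U μ K n →
                  (klPredsV17F2.engine L M G P Q β U μ K n ∧ klPredsV17F2.twoLeg L M G P Q R β U μ K n) ∧
                  (∀ m : ℕ, 1 ≤ m → m < n → FlowPieceOscAt L M c'' β U μ m) ∧
                  (∀ k : ℕ, k < n → hubbardEffPartitionFnCT L M β U μ 0 (klFlowFrameU L M β U μ n) (klScale klE0 (k + 1)) ≠ 0) ∧
                  (∀ j : ℕ, j < n → ∀ p : ℕ, 2 ≤ p → ∀ (q : Fin (2 * p)) (w : SpaceTimeIdx L M × SectorLeg (sectorCount j)),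
                    klWtPinnedSumAt L M β μ (klFlowFrameU L M β U μ n) j j (2 * p)
                      (klEffectiveAction L M β U μ (klFlowFrameU L M β U μ n) klE0 (j + 1)) q w ≤ C₀ * klWtBudget P Q U (j + 1) (2 * p)) ∧
                  (∀ j : ℕ, j < n → ∀ (q : Fin 2) (w : SpaceTimeIdx L M × SectorLeg (sectorCount j)),
                    klWtPinnedSumAt L M β μ (klFlowFrameU L M β U μ n) j j 2
                      (klEffectiveAction L M β U μ (klFlowFrameU L M β U μ n) klE0 (j + 1)) q w ≤
                        C₀ * Q.CE * epsCoupling P U n * ((4 : ℝ) ^ (j + 1))⁻¹)) :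
    ∀ (P : SplitConsts) (R : RenConsts), P.WF → R.WF2 →
      ∃ Q₁ : EngConsts, 0 ≤ Q₁.CE ∧ ∃ C₀ : ℝ, 0 ≤ C₀ ∧
        ∃ c₇ : ℝ, 0 < c₇ ∧ ∀ c : ℝ, 0 < c → c ≤ c₇ → ∃ U₇ : ℝ, 0 < U₇ ∧
          ∀ μ ∈ klWindowC, ∀ U : ℝ, 0 < U → U ≤ U₇ → ∀ β : ℝ, klBetaMin ≤ β → β ≤ Real.exp (c / U ^ 2) →
            ∃ S₀ : ℕ → ℕ → ℝ, (∀ j m, 0 ≤ S₀ j m) ∧ (∀ j, j ≤ nScales β → ∀ m, 2 ≤ m → S₀ j (2 * m) ≤ C₀ * klWtBudget P Q₁ U (j + 1) (2 * m)) ∧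
            (∀ j, j ≤ nScales β → S₀ j 2 ≤ C₀ * Q₁.CE * epsCoupling P U (nScales β + 1) * ((4 : ℝ) ^ (j + 1))⁻¹) ∧
            ∃ L₂ : ℕ, ∃ M₂ : ℕ → ℕ, ∀ (L M : ℕ) [NeZero L] [NeZero M], L₂ ≤ L → M₂ L ≤ M →
              (∀ k, k ≤ nScales β → hubbardEffPartitionFnCT L M β U μ 0 (klFlowFrameU L M β U μ (nScales β + 1)) (klScale klE0 (k + 1)) ≠ 0) ∧
              (∀ j, j ≤ nScales β → ∀ (m : ℕ) (q : Fin m) (w : SpaceTimeIdx L M × SectorLeg (sectorCount j)),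
                klWtPinnedSumAt L M β μ (klFlowFrameU L M β U μ (nScales β + 1)) j j m (klEffectiveAction L M β U μ (klFlowFrameU L M β U μ (nScales β + 1)) klE0 (j + 1)) q w ≤ S₀ j m) :=
  he1free'_of_htopFree' (htopFree'_of_children (betaSplitP_klPredsV17F2 klWindowC) countertermP2_klPredsV17F2_holds hX)

set_option maxHeartbeats 1600000 in -- long binders
/-- **`stub_vl_flowPieceOscTE` (v12W-9 text, 398b3e3a086b) FROM ENG-X ALONE** (p2 g25's `hoscTAtom_of_engineOsc` ∘ `engineOsc_of_engineP4X`).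
[cite: BenfattoGiulianiMastropietro2006, §2.4 (2.36)] -/
theorem oscTE_of_engineP4X
    (hX : ∃ G : GeoConsts, G.WF ∧ ∀ P : SplitConsts, P.WF → ∀ R : RenConsts, R.WF2 → ∃ Q : EngConsts, Q.WF ∧ ∃ c₃ : ℝ, 0 < c₃ ∧
      ∃ c'' : ℝ, 0 ≤ c'' ∧ ∃ C₀ : ℝ, 0 ≤ C₀ ∧ ∀ c : ℝ, 0 < c → c ≤ c₃ →
        ∃ U₀ : ℝ, 0 < U₀ ∧ ∃ L₃ : ℝ → ℝ → ℕ, ∃ M₃ : ℝ → ℝ → ℕ → ℕ,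
          ∀ μ ∈ klWindowC, ∀ U : ℝ, 0 < U → U ≤ U₀ → ∀ β : ℝ, klBetaMin ≤ β → β ≤ Real.exp (c / U ^ 2) →
            ∀ K : TrigPolyC4v, klPredsV17F2.frameOK R U (nScales β) μ K →
              ∀ (L M : ℕ) [NeZero L] [NeZero M], L₃ β U ≤ L → M₃ β U L ≤ M →
                ∀ n : ℕ, n ≤ nScales β + 1 → IsKLRegime U c (-(n : ℤ)) → HistP klPredsV17F2 L M G P Q R β U μ K n →
                  (klPredsV17F2.engine L M G P Q β U μ K n ∧ klPredsV17F2.twoLeg L M G P Q R β U μ K n) ∧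
                  (∀ m : ℕ, 1 ≤ m → m < n → FlowPieceOscAt L M c'' β U μ m) ∧
                  (∀ k : ℕ, k < n → hubbardEffPartitionFnCT L M β U μ 0 (klFlowFrameU L M β U μ n) (klScale klE0 (k + 1)) ≠ 0) ∧
                  (∀ j : ℕ, j < n → ∀ p : ℕ, 2 ≤ p → ∀ (q : Fin (2 * p)) (w : SpaceTimeIdx L M × SectorLeg (sectorCount j)),
                    klWtPinnedSumAt L M β μ (klFlowFrameU L M β U μ n) j j (2 * p)
                      (klEffectiveAction L M β U μ (klFlowFrameU L M β U μ n) klE0 (j + 1)) q w ≤ C₀ * klWtBudget P Q U (j + 1) (2 * p)) ∧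
                  (∀ j : ℕ, j < n → ∀ (q : Fin 2) (w : SpaceTimeIdx L M × SectorLeg (sectorCount j)),
                    klWtPinnedSumAt L M β μ (klFlowFrameU L M β U μ n) j j 2
                      (klEffectiveAction L M β U μ (klFlowFrameU L M β U μ n) klE0 (j + 1)) q w ≤
                        C₀ * Q.CE * epsCoupling P U n * ((4 : ℝ) ^ (j + 1))⁻¹)) :
    ∀ (G : GeoConsts) (P : SplitConsts) (Q : EngConsts) (R : RenConsts), P.WF → R.WF2 →
      ∃ c'' : ℝ, 0 ≤ c'' ∧ ∃ c₇ : ℝ, 0 < c₇ ∧ ∀ c : ℝ, 0 < c → c ≤ c₇ → ∃ U₇ : ℝ, 0 < U₇ ∧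
        ∀ μ ∈ klWindowC, ∀ U : ℝ, 0 < U → U ≤ U₇ → ∀ β : ℝ, klBetaMin ≤ β → β ≤ Real.exp (c / U ^ 2) →
          ∀ (K : TrigPolyC4v) (Lstar : ℕ) (Mstar : ℕ → ℕ), TowerP klPredsV17F2 G P Q R β U μ K Lstar Mstar →
          ∃ L₂ : ℕ, ∃ M₂ : ℕ → ℕ, ∀ (L M : ℕ) [NeZero L] [NeZero M], L₂ ≤ L → M₂ L ≤ M →
            ∀ m : ℕ, 1 ≤ m → m < nScales β + 1 → FlowPieceOscAt L M c'' β U μ m :=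
  hoscTAtom_of_engineOsc (engineOsc_of_engineP4X hX)

end Summit.HubbardSuperconductivity.HubbardSuperconductivity.Theorems.KLRegimeSplit

end
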